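import Mathlib
import Summits.Schanuel.Schanuel.Theses.RigidCore
import Summits.Schanuel.Schanuel.Theorems.RigidCoreMinimalCounterexampleInAclLogSector
import Summits.Schanuel.Schanuel.Theorems.RigidCoreMinimalCounterexampleInAclRelationIdealMinimal
import Summits.Schanuel.Schanuel.Theorems.RigidCoreMinimalCounterexampleInAclOfSparsityTwo
import Literature.NumberTheory.Transcendental.TrdegZariskiDimConverse
import Literature.NumberTheory.Transcendental.LindemannWeierstrassProofs

/-!
# The rank-2 residue of the line `kernel-arithmetic-selection` IS the crux `SparsityTwo`

Route `RigidCore`, crux (S*) `MinimalCounterexampleInAcl` (item stmt-Schanuel-0969), `--supports stmt-Schanuel-0969`,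
registered stub `sparsityTwo_iff_rankTwo_locusMates_finite` (lead prover-line-stmt-Schanuel-0969-c2-0; statement registered by
lead -1).

The line proves (S*) from FINITENESS OF THE MATE SET `locusMates x` of a first failure `x` (definable isolation is free,
`coord_mem_expAcl_of_sparsity`).  At the first open rank `n = 2` this finiteness, quantified over all rank-2 first
failures, is EQUIVALENT to the sibling crux `SparsityTwo` (stmt-Schanuel-0971: a `ℚ`-defined `W ⊆ ℂ² × ℂ²` of Zariski
dimension `< 2` carries finitely many `ℚ`-linearly independent exponential points):

* `→` (`locusMates_finite_of_sparsityTwo`): the point `(x, eˣ)` of a rank-2 first failure lies on such a `W`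
  (`exists_mem_indepExpPoints_of_trdeg_lt_two`) and every mate lies on the same `W`
  (`mem_of_isDefinedOver_bot_of_relations`);
* `←` (`indepExpPoints_finite_of_locusMates_finite`): an independent exponential point `x` of `W = Z(I)` is a rank-2
  first failure (`trdeg < 2` by `trdeg_adjoin_lt_of_mem_of_zariskiDim_lt`; ranks `0, 1` of Schanuel are theorems), its
  relation ideal `P_x = ker (aeval (x, eˣ)) ⊆ ℚ[X, Y]` is a MINIMAL PRIME over the `ℚ`-ideal `J` of `W`
  (`ker_aeval_mem_minimalPrimes`, landed: some coordinate of `(x, eˣ)` is transcendental by Hermite–Lindemann, and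
  `dim Z_ℂ(J) = zariskiDim W ≤ 1`), there are finitely many minimal primes (`ℚ[X, Y]` is Noetherian), and two independent
  points with the same relation ideal are mates of each other — so the independent points of `W` are a finite union of
  mate sets.

Hence `sparsityTwo_iff_rankTwo_locusMates_finite`: for the planners, crux 0969 restricted to rank 2, in this line's
reduction, is crux 0971 verbatim (neither weaker nor stronger), and crux 0969 = glue(0971, 14744) (landed stmt-14765).

References: J. Kirby, *Exponential algebraicity in exponential fields*, arXiv:0810.4285, Prop. 7.2; U. Görtz, T. Wedhorn,
*Algebraic Geometry I* (2020), Prop. 5.38.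
-/

noncomputable section

set_option linter.dupNamespace false

open Complex Set
open Literature.NumberTheory.Transcendental

namespace Summit.Schanuel.Schanuel.Cruxes.MinimalCounterexampleInAcl.KernelArithmeticSelection

open Summit.Schanuel.Schanuel.Theorems

/-! ## Small facts -/

/-- A ℚ-linearly independent tuple `x` has a transcendental coordinate among `(x, eˣ)`: `x 0 ≠ 0`, so by
Hermite–Lindemann `x 0` or `e^{x 0}` is transcendental. [folklore] -/
theorem exists_transcendental_coord {n : ℕ} {x : Fin (n + 1) → ℂ} (hx : LinearIndependent ℚ x) :
    ∃ i, Transcendental ℚ (Sum.elim x (cexp ∘ x) i) := by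
  have hx0 : x 0 ≠ 0 := hx.ne_zero 0
  by_cases halg : IsAlgebraic ℚ (x 0)
  · exact ⟨Sum.inr 0, transcendental_exp_holds halg hx0⟩
  · exact ⟨Sum.inl 0, halg⟩

/-- Two ℚ-linearly independent tuples whose exponential points have the same relation ideal over `ℚ` are mates.
[folklore] -/
theorem mem_locusMates_of_ker_le {n : ℕ} {x x' : Fin n → ℂ} (hx' : LinearIndependent ℚ x')
    (h : RingHom.ker (MvPolynomial.aeval (Sum.elim x (cexp ∘ x)) : MvPolynomial (Fin n ⊕ Fin n) ℚ →ₐ[ℚ] ℂ) ≤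
      RingHom.ker (MvPolynomial.aeval (Sum.elim x' (cexp ∘ x')) : MvPolynomial (Fin n ⊕ Fin n) ℚ →ₐ[ℚ] ℂ)) :
    x' ∈ locusMates x := by
  refine ⟨hx', fun p hp => ?_⟩
  have hp' : p ∈ RingHom.ker (MvPolynomial.aeval (Sum.elim x (cexp ∘ x)) : MvPolynomial (Fin n ⊕ Fin n) ℚ →ₐ[ℚ] ℂ) :=
    (RingHom.mem_ker).2 hp
  exact (RingHom.mem_ker).1 (h hp')

/-- An independent exponential point of a `ℚ`-variety of dimension `< 2` in `ℂ² × ℂ²` is a rank-2 first failure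
(`trdeg ℚ(x, eˣ) < 2`; Schanuel in ranks `0, 1` holds). [folklore] -/
theorem mem_firstFailures_two_of_mem {W : Set (Fin 2 ⊕ Fin 2 → ℂ)} (hW : IsDefinedOver (⊥ : Subfield ℂ) W)
    (hd : zariskiDim ℂ W < 2) {x : Fin 2 → ℂ} (hx : LinearIndependent ℚ x) (hxW : Sum.elim x (cexp ∘ x) ∈ W) :
    x ∈ firstFailures 2 := by
  refine ⟨hx, ?_, ?_⟩
  · have h := trdeg_adjoin_lt_of_mem_of_zariskiDim_lt (d := 2) hW hxW (by exact_mod_cast hd)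
    rw [Set.Sum.elim_range] at h
    exact_mod_cast h
  · intro r hr
    interval_cases r
    · exact schanuelRank_zero
    · exact schanuelRank_one

/-! ## `SparsityTwo` ⟹ mate finiteness at rank 2 -/

/-- **`SparsityTwo` gives finiteness of the mate set of every rank-2 first failure**: `(x, eˣ)` lies on a `ℚ`-curve `W`
of dimension `< 2` and so does every mate. [folklore] -/
theorem locusMates_finite_of_sparsityTwo (hSp : Summit.Schanuel.Schanuel.Theses.RigidCore.SparsityTwo)
    {x : Fin 2 → ℂ} (hx : x ∈ firstFailures 2) : (locusMates x).Finite := by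
  obtain ⟨W, hW, hd, hxW⟩ := exists_mem_indepExpPoints_of_trdeg_lt_two hx.1 (by exact_mod_cast hx.2.1)
  refine (hSp W hW hd).subset ?_
  rintro x' ⟨hx', hrel⟩
  exact ⟨hx', mem_of_isDefinedOver_bot_of_relations hW hxW.2 hrel⟩

/-! ## Mate finiteness at rank 2 ⟹ `SparsityTwo` -/

/-- **Finiteness of the mate sets of rank-2 first failures gives `SparsityTwo`.**  The relation ideals of the independent
exponential points of `W = Z(I)` are minimal primes over the `ℚ`-ideal of `W` — finitely many — and each fibre of
`x ↦ P_x` is contained in one mate set. [cite: GortzWedhorn2020, Prop. 5.38] -/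
theorem indepExpPoints_finite_of_locusMates_finite
    (hfin : ∀ x : Fin 2 → ℂ, x ∈ firstFailures 2 → (locusMates x).Finite)
    (W : Set (Fin 2 ⊕ Fin 2 → ℂ)) (hW : IsDefinedOver (⊥ : Subfield ℂ) W) (hd : zariskiDim ℂ W < 2) :
    Set.Finite {x : Fin 2 → ℂ | LinearIndependent ℚ x ∧ Sum.elim x (cexp ∘ x) ∈ W} := by
  classical
  obtain ⟨I, hI⟩ := hW
  -- the `ℚ`-ideal of `W`
  set J : Ideal (MvPolynomial (Fin 2 ⊕ Fin 2) ℚ) := I.comap (MvPolynomial.map ratToBot) with hJ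
  have hWJ : W = MvPolynomial.zeroLocus ℂ J := by
    rw [hI]
    ext w
    simp only [MvPolynomial.mem_zeroLocus_iff]
    constructor
    · intro h g hg
      have := h _ (Ideal.mem_comap.1 hg)
      rwa [aeval_map_ratToBot] at this
    · intro h f hf
      obtain ⟨g, rfl⟩ := MvPolynomial.map_surjective ratToBot ratToBot_surjective f
      rw [aeval_map_ratToBot]
      exact h g (Ideal.mem_comap.2 hf)
  have hdimJ : ringKrullDim (MvPolynomial (Fin 2 ⊕ Fin 2) ℂ ⧸
      MvPolynomial.vanishingIdeal ℂ (MvPolynomial.zeroLocus ℂ J)) ≤ 1 := by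
    have h : zariskiDim ℂ (MvPolynomial.zeroLocus ℂ J) < 2 := by rwa [← hWJ]
    exact withBot_enat_le_one_of_lt_two h
  -- the relation ideal of a point
  let P : (Fin 2 → ℂ) → Ideal (MvPolynomial (Fin 2 ⊕ Fin 2) ℚ) := fun x =>
    RingHom.ker (MvPolynomial.aeval (Sum.elim x (cexp ∘ x)) : MvPolynomial (Fin 2 ⊕ Fin 2) ℚ →ₐ[ℚ] ℂ)
  set S : Set (Fin 2 → ℂ) := {x : Fin 2 → ℂ | LinearIndependent ℚ x ∧ Sum.elim x (cexp ∘ x) ∈ W} with hS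
  -- relation ideals of points of `S` are minimal primes over `J`
  have hmin : ∀ x ∈ S, P x ∈ J.minimalPrimes := by
    rintro x ⟨hx, hxW⟩
    rw [hWJ, MvPolynomial.mem_zeroLocus_iff] at hxW
    obtain ⟨i, hi⟩ := exists_transcendental_coord hx
    exact ker_aeval_mem_minimalPrimes J hdimJ hxW hi
  have hfinmin : J.minimalPrimes.Finite := Ideal.finite_minimalPrimes_of_isNoetherianRing _ J
  -- `S` is the union over the minimal primes of the fibres of `P`, each inside one mate set
  refine (hfinmin.biUnion (t := fun 𝔭 => {x ∈ S | P x = 𝔭}) ?_).subset ?_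
  · intro 𝔭 _
    by_cases hne : ({x ∈ S | P x = 𝔭} : Set (Fin 2 → ℂ)).Nonempty
    · obtain ⟨x₀, hx₀S, hx₀P⟩ := hne
      have hff : x₀ ∈ firstFailures 2 := by
        refine mem_firstFailures_two_of_mem ⟨I, hI⟩ hd hx₀S.1 hx₀S.2
      refine (hfin x₀ hff).subset ?_
      rintro x' ⟨hx'S, hx'P⟩
      refine mem_locusMates_of_ker_le hx'S.1 ?_
      change P x₀ ≤ P x'
      rw [hx₀P, hx'P]
    · rw [Set.not_nonempty_iff_eq_empty.1 hne]
      exact Set.finite_empty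
  · intro x hx
    exact Set.mem_iUnion₂.2 ⟨P x, hmin x hx, hx, rfl⟩

/-! ## The registered stub -/

/-- **Registered stub `sparsityTwo_iff_rankTwo_locusMates_finite` (PROVED): the crux `SparsityTwo` (stmt-Schanuel-0971) is
EQUIVALENT to finiteness of the mate set of every rank-2 first failure** — the rank-2 residue of the line
`kernel-arithmetic-selection` for (S*) is crux 0971 verbatim. [cite: GortzWedhorn2020, Prop. 5.38] -/
theorem sparsityTwo_iff_rankTwo_locusMates_finite : Summit.Schanuel.Schanuel.Theses.RigidCore.SparsityTwo ↔ ∀ x : Fin 2 → ℂ, x ∈ Summit.Schanuel.Schanuel.Cruxes.MinimalCounterexampleInAcl.KernelArithmeticSelection.firstFailures 2 → (Summit.Schanuel.Schanuel.Cruxes.MinimalCounterexampleInAcl.KernelArithmeticSelection.locusMates x).Finite := by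
  constructor
  · intro hSp x hx
    exact locusMates_finite_of_sparsityTwo hSp hx
  · intro hfin W hW hd
    exact indepExpPoints_finite_of_locusMates_finite hfin W hW hd

/-- **Corollary: (S*) at rank 2 from mate finiteness in the crux's own vocabulary** — if every rank-2 first failure has a
finite mate set then every coordinate of every rank-2 first failure lies in a finite `∅`-definable subset of `ℂ_exp`.
[folklore] -/
theorem rankTwo_crux_of_locusMates_finite
    (hfin : ∀ x : Fin 2 → ℂ, x ∈ firstFailures 2 → (locusMates x).Finite) {x : Fin 2 → ℂ} (hx : x ∈ firstFailures 2)
    (i : Fin 2) :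
    ∃ s : Set ℂ, s.Finite ∧ Set.Definable₁ (∅ : Set ℂ) Literature.ModelTheory.ExponentialFields.Language.expRing s ∧
      x i ∈ s :=
  coord_mem_expAcl_of_sparsity hx (hfin x hx) i

end Summit.Schanuel.Schanuel.Cruxes.MinimalCounterexampleInAcl.KernelArithmeticSelection

end
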